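import Literature.NumberTheory.EllipticCurves.BSDSelmerPConverseSerreProofs
import Literature.NumberTheory.EllipticCurves.HeegnerPointsKolyvaginLocalCriterion
import HarnessLib

/-!
# `#H¹(K(E[2^k])/K, E[2^k]) ≤ 2` for surjective `ρ̄_{E,2^k}` — PART 1: the arithmetic of
# `GL₂(ℤ/2^k)` acting on `(ℤ/2^k)²` in a frame of `E[2^k]` (Lawson–Wuthrich 2016 at the even prime)

`Proofs`-style file (THEOREMS ONLY).  Elementary inputs for discharging the hypotheses of the abstract
criterion `Rubin1987.natCard_subgroupResKer_le_two` (`DivisionTowerH1OrderTwoCriterion`) for an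
elliptic curve with surjective mod-`2^k` representation: the arithmetic of `ℤ/2^k` around the element
`h = 2^{k-1}` (`2h = 0`; `2a = 0 ⇒ a ∈ {0, h}`; `ah = 0 ⇒ a` even; units are `1 + 2c`), `2 × 2` matrix
identities for the transvections `T = (1 1; 0 1)`, `T' = (1 0; 1 1)`, the swap `S` and diagonal matrices
(`S T = T' S`, `T^n = (1 n; 0 1)`, `T D = D T^{2m+1}` …), and, for a frame `e : E[n] ≃ (ℤ/n)²` with framed
representation `ρ` (`exists_rep_of_addEquiv`), the SURJECTIVITY `∀ B ∈ GL₂(ℤ/n), ∃ σ, ρ σ = B` from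
`HasSurjectiveModNGaloisRep` and `ker ρ ≤ Γ_{K(E[n])}`.  «beyond-print theorem»: no.  BSD is NOT proved
by this file.

References: T. Lawson, C. Wuthrich, *Vanishing of some Galois cohomology groups for elliptic curves*
(2016), §2, §7.1 [LawsonWuthrich2016]; J.-P. Serre, *Propriétés galoisiennes des points d'ordre fini des
courbes elliptiques* (1972), §4 [Serre1972].
-/

set_option autoImplicit false

noncomputable section

open scoped Classical MatrixGroups

open WeierstrassCurve Field Matrix

universe u

namespace Literature.NumberTheory.EllipticCurves

namespace LawsonWuthrich2016

/-! #### `ℤ/2^(j+1)` around `h = 2^j` -/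

section ZModTwoPow

variable (j : ℕ)

/-- Cast bridge: `((2^j : ℕ) : ℤ/2^{j+1}) = 2^j`. [folklore] -/
private theorem natCast_two_pow : ((2 ^ j : ℕ) : ZMod (2 ^ (j + 1))) = (2 : ZMod (2 ^ (j + 1))) ^ j := by
  rw [Nat.cast_pow, Nat.cast_ofNat]

/-- `2 · 2^j = 0` in `ℤ/2^{j+1}`. [cite: LawsonWuthrich2016, §7.1 (p = 2)] -/
theorem two_mul_half_eq_zero : (2 : ZMod (2 ^ (j + 1))) * (2 : ZMod (2 ^ (j + 1))) ^ j = 0 := by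
  have h : ((2 * 2 ^ j : ℕ) : ZMod (2 ^ (j + 1))) = 0 := by
    rw [show 2 * 2 ^ j = 2 ^ (j + 1) by ring, ZMod.natCast_self]
  rwa [Nat.cast_mul, Nat.cast_ofNat, natCast_two_pow] at h

/-- `2^j ≠ 0` in `ℤ/2^{j+1}`. [cite: LawsonWuthrich2016, §7.1 (p = 2)] -/
theorem half_ne_zero : (2 : ZMod (2 ^ (j + 1))) ^ j ≠ 0 := by
  rw [← natCast_two_pow, Ne, ZMod.natCast_eq_zero_iff]
  intro h
  have := Nat.le_of_dvd (pow_pos two_pos j) h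
  have : 2 ^ j < 2 ^ (j + 1) := Nat.pow_lt_pow_right (by norm_num) (Nat.lt_succ_self j)
  omega

/-- In `ℤ/2^{j+1}`: `2a = 0 ⇒ a = 0 ∨ a = 2^j`. [cite: LawsonWuthrich2016, §7.1 (p = 2)] -/
theorem eq_zero_or_eq_half_of_two_mul_eq_zero (a : ZMod (2 ^ (j + 1))) (ha : 2 * a = 0) :
    a = 0 ∨ a = (2 : ZMod (2 ^ (j + 1))) ^ j := by
  haveI : NeZero (2 ^ (j + 1)) := ⟨pow_ne_zero _ two_ne_zero⟩
  have h2 : ((2 * a.val : ℕ) : ZMod (2 ^ (j + 1))) = 0 := by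
    rw [Nat.cast_mul, Nat.cast_ofNat, ZMod.natCast_zmod_val, ha]
  have hdvd : 2 ^ (j + 1) ∣ 2 * a.val := (ZMod.natCast_eq_zero_iff _ _).1 h2
  have hdvd' : 2 * 2 ^ j ∣ 2 * a.val := by rw [mul_comm 2 (2 ^ j), ← pow_succ]; exact hdvd
  obtain ⟨c, hc⟩ := Nat.dvd_of_mul_dvd_mul_left two_pos hdvd'
  have hlt : a.val < 2 ^ (j + 1) := ZMod.val_lt a
  rw [hc, pow_succ] at hlt
  have hc2 : c < 2 := by
    by_contra hc2
    have : 2 ^ j * 2 ≤ 2 ^ j * c := Nat.mul_le_mul_left _ (not_lt.1 hc2)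
    omega
  have ha' : a = ((a.val : ℕ) : ZMod (2 ^ (j + 1))) := (ZMod.natCast_zmod_val a).symm
  interval_cases c
  · left; rw [ha', hc, mul_zero, Nat.cast_zero]
  · right; rw [ha', hc, mul_one, natCast_two_pow]

/-- In `ℤ/2^{j+1}`: `a · 2^j = 0 ⇒ a = 2c` for some `c`. [cite: LawsonWuthrich2016, §7.1 (p = 2)] -/
theorem exists_eq_two_mul_of_mul_half_eq_zero (a : ZMod (2 ^ (j + 1)))
    (ha : a * (2 : ZMod (2 ^ (j + 1))) ^ j = 0) : ∃ c : ZMod (2 ^ (j + 1)), a = 2 * c := by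
  haveI : NeZero (2 ^ (j + 1)) := ⟨pow_ne_zero _ two_ne_zero⟩
  have h : ((a.val * 2 ^ j : ℕ) : ZMod (2 ^ (j + 1))) = 0 := by
    rw [Nat.cast_mul, ZMod.natCast_zmod_val, natCast_two_pow, ha]
  have h' : 2 ^ (j + 1) ∣ a.val * 2 ^ j := (ZMod.natCast_eq_zero_iff _ _).1 h
  have h'' : 2 ^ j * 2 ∣ 2 ^ j * a.val := by rw [← pow_succ, mul_comm (2 ^ j) a.val]; exact h'
  obtain ⟨c, hc⟩ := Nat.dvd_of_mul_dvd_mul_left (pow_pos two_pos j) h''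
  refine ⟨(c : ZMod (2 ^ (j + 1))), ?_⟩
  rw [← ZMod.natCast_zmod_val a, hc, Nat.cast_mul, Nat.cast_ofNat]

/-- In `ℤ/2^{j+1}`: `(1 + 2c) · 2^j = 2^j`. [cite: LawsonWuthrich2016, §7.1 (p = 2)] -/
theorem one_add_two_mul_mul_half (c : ZMod (2 ^ (j + 1))) :
    (1 + 2 * c) * (2 : ZMod (2 ^ (j + 1))) ^ j = (2 : ZMod (2 ^ (j + 1))) ^ j := by
  rw [add_mul, one_mul, mul_assoc, mul_comm c, ← mul_assoc, two_mul_half_eq_zero, zero_mul, add_zero]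

/-- In `ℤ/2^{j+1}`: `1 + 2c` is a unit. [cite: LawsonWuthrich2016, §7.1 (p = 2)] -/
theorem isUnit_one_add_two_mul (c : ZMod (2 ^ (j + 1))) : IsUnit (1 + 2 * c : ZMod (2 ^ (j + 1))) := by
  haveI : NeZero (2 ^ (j + 1)) := ⟨pow_ne_zero _ two_ne_zero⟩
  have h : ((1 + 2 * c.val : ℕ) : ZMod (2 ^ (j + 1))) = 1 + 2 * c := by
    rw [Nat.cast_add, Nat.cast_one, Nat.cast_mul, Nat.cast_ofNat, ZMod.natCast_zmod_val]
  rw [← h, ZMod.isUnit_iff_coprime]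
  exact Nat.Coprime.pow_right _ (Nat.coprime_two_right.2 ⟨c.val, by ring⟩)

/-- In `ℤ/2^{j+1}`: a unit is `1 + 2c`. [cite: LawsonWuthrich2016, §7.1 (p = 2)] -/
theorem exists_unit_eq_one_add_two_mul (x : (ZMod (2 ^ (j + 1)))ˣ) :
    ∃ c : ZMod (2 ^ (j + 1)), (x : ZMod (2 ^ (j + 1))) = 1 + 2 * c := by
  haveI : NeZero (2 ^ (j + 1)) := ⟨pow_ne_zero _ two_ne_zero⟩
  have hcop : Nat.Coprime (x : ZMod (2 ^ (j + 1))).val (2 ^ (j + 1)) := ZMod.val_coe_unit_coprime x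
  have hodd : Odd (x : ZMod (2 ^ (j + 1))).val :=
    Nat.coprime_two_right.1 (hcop.coprime_dvd_right (dvd_pow_self 2 (Nat.succ_ne_zero j)))
  obtain ⟨m, hm⟩ := hodd
  refine ⟨(m : ZMod (2 ^ (j + 1))), ?_⟩
  rw [← ZMod.natCast_zmod_val (x : ZMod (2 ^ (j + 1))), hm]
  push_cast
  ring

/-- In `ℤ/2^{j+1}`: the difference of two units is even. [cite: LawsonWuthrich2016, §7.1 (p = 2)] -/
theorem exists_units_sub_eq_two_mul (x y : (ZMod (2 ^ (j + 1)))ˣ) :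
    ∃ c : ZMod (2 ^ (j + 1)), (y : ZMod (2 ^ (j + 1))) - x = 2 * c := by
  obtain ⟨a, ha⟩ := exists_unit_eq_one_add_two_mul j x
  obtain ⟨b, hb⟩ := exists_unit_eq_one_add_two_mul j y
  exact ⟨b - a, by rw [ha, hb]; ring⟩

end ZModTwoPow

/-! #### `2 × 2` matrix identities -/

section Matrices

variable {R : Type*} [CommRing R]

/-- `S T = T' S` for the swap and the two transvections of `GL₂`. [cite: LawsonWuthrich2016, §2] -/
theorem swap_mul_transvection :
    (!![0, 1; 1, 0] : Matrix (Fin 2) (Fin 2) R) * !![1, 1; 0, 1] = !![1, 0; 1, 1] * !![0, 1; 1, 0] := by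
  ext i j; fin_cases i <;> fin_cases j <;> simp [Matrix.mul_apply, Fin.sum_univ_two]

/-- `T^n = (1 n; 0 1)`. [cite: LawsonWuthrich2016, §2] -/
theorem transvection_pow (n : ℕ) :
    (!![1, 1; 0, 1] : Matrix (Fin 2) (Fin 2) R) ^ n = !![1, (n : R); 0, 1] := by
  induction n with
  | zero => ext i j; fin_cases i <;> fin_cases j <;> simp
  | succ n ih =>
    rw [pow_succ, ih]
    ext i j; fin_cases i <;> fin_cases j <;> simp [Matrix.mul_apply, Fin.sum_univ_two, add_comm]

/-- `T'^n = (1 0; n 1)`. [cite: LawsonWuthrich2016, §2] -/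
theorem transvection'_pow (n : ℕ) :
    (!![1, 0; 1, 1] : Matrix (Fin 2) (Fin 2) R) ^ n = !![1, 0; (n : R), 1] := by
  induction n with
  | zero => ext i j; fin_cases i <;> fin_cases j <;> simp
  | succ n ih =>
    rw [pow_succ, ih]
    ext i j; fin_cases i <;> fin_cases j <;> simp [Matrix.mul_apply, Fin.sum_univ_two]

/-- `T D = D T^{2m+1}` for `D = diag(x, y)` with `y = x (2m + 1)`. [cite: LawsonWuthrich2016, §2] -/
theorem transvection_mul_diagonal (x y m : R) (h : y = x * (2 * m + 1)) :
    (!![1, 1; 0, 1] : Matrix (Fin 2) (Fin 2) R) * !![x, 0; 0, y] =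
      !![x, 0; 0, y] * !![1, 2 * m + 1; 0, 1] := by
  ext i j; fin_cases i <;> fin_cases j <;> simp [Matrix.mul_apply, Fin.sum_univ_two, h]

/-- `T' D = D T'^{2m+1}` for `D = diag(x, y)` with `x = y (2m + 1)`. [cite: LawsonWuthrich2016, §2] -/
theorem transvection'_mul_diagonal (x y m : R) (h : x = y * (2 * m + 1)) :
    (!![1, 0; 1, 1] : Matrix (Fin 2) (Fin 2) R) * !![x, 0; 0, y] =
      !![x, 0; 0, y] * !![1, 0; 2 * m + 1, 1] := by
  ext i j; fin_cases i <;> fin_cases j <;> simp [Matrix.mul_apply, Fin.sum_univ_two, h]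

/-- `LDU`: `(1 0; a 1) (α β; γ δ) (1 b; 0 1)` is DIAGONAL when `α b + β = 0` and `a α + γ = 0`.
[cite: LawsonWuthrich2016, §2] -/
theorem lower_mul_mul_upper_eq_diagonal (α β γ δ a b : R) (hb : α * b + β = 0)
    (ha : a * α + γ = 0) :
    (!![1, 0; a, 1] : Matrix (Fin 2) (Fin 2) R) * !![α, β; γ, δ] * !![1, b; 0, 1] =
      !![α, 0; 0, a * β + δ] := by
  ext i j; fin_cases i <;> fin_cases j <;> simp [Matrix.mul_apply, Fin.sum_univ_two]
  · linear_combination hb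
  · linear_combination ha
  · linear_combination b * ha

/-- Two matrices with the same action on column vectors are equal. [cite: LawsonWuthrich2016, §2] -/
theorem eq_of_forall_mulVec_eq {m : ℕ} (A B : Matrix (Fin 2) (Fin 2) (ZMod m))
    (h : ∀ v : Fin 2 → ZMod m, A *ᵥ v = B *ᵥ v) : A = B := by
  ext i j
  have := congr_fun (h (Pi.single j 1)) i
  simpa [Matrix.mulVec_single_one] using this

end Matrices

/-! #### Frames of `E[n]`: surjectivity and the kernel -/

section Frame

variable {K : Type u} [Field K] (W : WeierstrassCurve K) {m : ℕ}
  (e : geomTorsion W (m : ℤ) ≃+ (Fin 2 → ZMod m))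
  (ρ : absoluteGaloisGroup K →* GL (Fin 2) (ZMod m))
  (hρ : ∀ (σ : absoluteGaloisGroup K) (P : geomTorsion W (m : ℤ)),
    e (σ • P) = ((ρ σ : GL (Fin 2) (ZMod m)) : Matrix (Fin 2) (Fin 2) (ZMod m)) *ᵥ e P)

include hρ in
/-- In a frame, `σ • P = e⁻¹ (ρ(σ) · e P)`. [cite: LawsonWuthrich2016, §2 (G ≤ GL₂(ℤ/p^i))] -/
theorem smul_eq_symm_mulVec (σ : absoluteGaloisGroup K) (P : geomTorsion W (m : ℤ)) :
    σ • P = e.symm (((ρ σ : GL (Fin 2) (ZMod m)) : Matrix (Fin 2) (Fin 2) (ZMod m)) *ᵥ e P) := by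
  rw [← hρ, e.symm_apply_apply]

include hρ in
/-- **Surjectivity in a frame**: if `ρ̄_{E,m}` is surjective then every `B ∈ GL₂(ℤ/m)` is `ρ(σ)` for some
`σ ∈ Γ_K`. [cite: Serre1972, §4] [cite: LawsonWuthrich2016, §2] -/
theorem exists_rep_eq_of_hasSurjectiveModNGaloisRep (hsurj : W.HasSurjectiveModNGaloisRep (m : ℤ))
    (B : GL (Fin 2) (ZMod m)) : ∃ σ : absoluteGaloisGroup K, ρ σ = B := by
  -- the additive automorphism of `E[m]` with matrix `B`
  let φ₀ : (Fin 2 → ZMod m) ≃+ (Fin 2 → ZMod m) :=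
    { toFun := fun v ↦ (B : Matrix (Fin 2) (Fin 2) (ZMod m)) *ᵥ v
      invFun := fun v ↦ ((B⁻¹ : GL (Fin 2) (ZMod m)) : Matrix (Fin 2) (Fin 2) (ZMod m)) *ᵥ v
      left_inv := fun v ↦ by
        simp only [Matrix.mulVec_mulVec]
        rw [← Units.val_mul, inv_mul_cancel, Units.val_one, Matrix.one_mulVec]
      right_inv := fun v ↦ by
        simp only [Matrix.mulVec_mulVec]
        rw [← Units.val_mul, mul_inv_cancel, Units.val_one, Matrix.one_mulVec]
      map_add' := fun v w ↦ Matrix.mulVec_add _ v w }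
  let φ : geomTorsion W (m : ℤ) ≃+ geomTorsion W (m : ℤ) := e.trans (φ₀.trans e.symm)
  obtain ⟨σ, hσ⟩ := hsurj (Multiplicative.ofAdd φ)
  refine ⟨σ, Units.ext (eq_of_forall_mulVec_eq _ _ fun v ↦ ?_)⟩
  have h1 : σ • e.symm v = φ (e.symm v) := by
    rw [← galoisRepTorsion_apply, hσ]; rfl
  have h2 : e (σ • e.symm v) = ((ρ σ : GL (Fin 2) (ZMod m)) : Matrix (Fin 2) (Fin 2) (ZMod m)) *ᵥ v := by
    rw [hρ, e.apply_symm_apply]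
  rw [← h2, h1]
  change e (e.symm (φ₀ (e (e.symm v)))) = _
  rw [e.apply_symm_apply, e.apply_symm_apply]
  rfl

include hρ in
/-- **`ker ρ ≤ Γ_{K(E[m])}`** in a frame: elements with the same matrix differ by an element fixing
`E[m]` pointwise. [cite: LawsonWuthrich2016, §2 (G_i = Gal(K(E[p^i])/K) ≤ GL₂(ℤ/p^i))] -/
theorem exists_mem_torsionFixing_of_rep_eq {a b : absoluteGaloisGroup K} (h : ρ a = ρ b) :
    ∃ n ∈ torsionFixing W (m : ℤ), a = b * n := by
  refine ⟨b⁻¹ * a, (mem_torsionFixing_iff W _).2 fun P ↦ e.injective ?_, by rw [mul_inv_cancel_left]⟩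
  rw [mul_smul, hρ, hρ, h, Matrix.mulVec_mulVec, ← Units.val_mul, ← map_mul, inv_mul_cancel, map_one,
    Units.val_one, Matrix.one_mulVec]

end Frame

end LawsonWuthrich2016

end Literature.NumberTheory.EllipticCurves

end
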